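import Summits.ValiantsHypothesis.ValiantsHypothesis.Theorems.BarrierLeverGradientGenericFibreCountHilbert

/-!
# Route BarrierLever — item `GradientGenericFibreCount` (stmt-ValiantsHypothesis-19256),
# part 4/6: proof of `MReg` (forms with only the trivial common zero are a regular sequence)

Route: `𝔪 = ker constantCoeff`; `𝔪ᴺ ⊆ (H)` (homogeneous Nullstellensatz, tree
`FormsCommonZero` / `HomogeneousCommonZero`), so `H` is a system of parameters of the regular local
ring `K[x]_𝔪` and hence regular there (tree `SopRegular`); regularity descends to `K[x]` because the
prefix ideals are homogeneous (graded descent: `mem_of_mul_mem_of_constantCoeff_ne_zero`,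
`isWeaklyRegular_of_prefix`), and Koszul syzygies follow (tree
`hasKoszulSyzygies_of_isWeaklyRegular`). Main result `mreg_holds : MReg`.

Lean text authored by the cell planner seat `valiant-natproofs-p2` (gen 4, HOME/HBasis-p2g4.lean,
1431 lines, kernel-checked rc 0 / 0 sorries; referee REF-G12 §4 and REF-G13 §2 PASS incl. full
line-read), ported by the prover seat (namespace `…Theorems.BarrierLever.HBasis`, six files, split
only). Stated over a general field `K` where the scratch does.

WHAT THIS IS NOT: nothing here touches FSV Question 6 / crux stmt-14610 or `VP` vs `VNP`; the item
is the algebro-geometric half of `NaturalProofsAgainstAllLinearSizes` (stmt-20156), whose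
complexity half is `NaturalProofsAgainstAllLinearSizesOfCount` (stmt-19261).

References: Macaulay 1916 (H-bases); [CoxLittleOSheaUsing2005] Ch. 3 Thm. (5.5); Hartshorne III
Cor. 10.7 (generic smoothness, replaced here by the Jacobian/Kähler argument); tree files
`Koszul.RegularSequenceFirstHomology`, `ZeroDimensional.FinitenessTheorem`, `RegularLocalRing.SopRegular`.
-/

-- layout Summits/ValiantsHypothesis/ValiantsHypothesis forces the duplicated namespace component
set_option linter.dupNamespace false

open MvPolynomial Finset

namespace Summit.ValiantsHypothesis.ValiantsHypothesis.Theorems.BarrierLever.HBasis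

variable {K : Type*} [Field K] {σ : Type*} {ι : Type*} [Fintype ι]

/-! ## Proof of the stub `MReg` (Macaulay: forms with only the trivial common zero are a
regular sequence)

Route: `𝔪 = ker constantCoeff`; `𝔪ᴺ ⊆ (H)` (Nullstellensatz, tree `exists_X_pow_mem_span` +
`idealDegree_eq_of_X_pow_mem`); in the regular local ring `S_𝔪` of dimension `k`
(`height_ker_constantCoeff`) the images of `H_1, …, H_k` are a system of parameters, hence a
regular sequence (tree `isRegular_of_maximalIdeal_pow_le_ofList`); regularity descends to `S`
because the prefix ideals are homogeneous (graded descent). -/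

section MRegProof

attribute [local instance] MvPolynomial.gradedAlgebra

open IsLocalRing RingTheory.Sequence Literature.RingTheory.MvPolynomial

omit [Fintype ι] in
/-- Expansion of the degree-`n` component of a product along the components of the first
factor. -/
theorem homogeneousComponent_mul_expand (s f : MvPolynomial σ K) (n : ℕ) :
    homogeneousComponent n (s * f) = ∑ a ∈ Finset.range (s.totalDegree + 1),
      (if a ≤ n then homogeneousComponent (n - a) f * homogeneousComponent a s else 0) := by
  classical
  conv_lhs => rw [← sum_homogeneousComponent s, Finset.sum_mul, map_sum]
  refine Finset.sum_congr rfl fun a _ => ?_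
  rw [mul_comm, homogeneousComponent_mul_form (homogeneousComponent_isHomogeneous a s)]

omit [Fintype ι] in
/-- **Graded descent**: if `I` is a homogeneous ideal, `s` has non-zero constant term and
`s f ∈ I`, then `f ∈ I`. -/
theorem mem_of_mul_mem_of_constantCoeff_ne_zero {I : Ideal (MvPolynomial σ K)}
    (hI : I.IsHomogeneous (homogeneousSubmodule σ K)) {s f : MvPolynomial σ K}
    (hs : constantCoeff s ≠ 0) (h : s * f ∈ I) : f ∈ I := by
  classical
  suffices hcomp : ∀ n, homogeneousComponent n f ∈ I by
    rw [← sum_homogeneousComponent f]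
    exact Ideal.sum_mem _ fun n _ => hcomp n
  intro n
  induction n using Nat.strong_induction_on with
  | _ n ih =>
    have hn : homogeneousComponent n (s * f) ∈ I :=
      MvPolynomial.homogeneousComponent_mem_of_mem hI h n
    rw [homogeneousComponent_mul_expand,
      Finset.sum_eq_add_sum_sdiff_singleton_of_mem (Finset.mem_range.2 (Nat.succ_pos _))] at hn
    have hrest : (∑ a ∈ Finset.range (s.totalDegree + 1) \ {0},
        (if a ≤ n then homogeneousComponent (n - a) f * homogeneousComponent a s else 0)) ∈ I := by
      refine Ideal.sum_mem _ fun a ha => ?_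
      have ha0 : a ≠ 0 := by
        rw [Finset.mem_sdiff, Finset.mem_singleton] at ha; exact ha.2
      split_ifs with hle
      · exact I.mul_mem_right _ (ih (n - a) (by omega))
      · exact I.zero_mem
    have h0 : homogeneousComponent n f * homogeneousComponent 0 s ∈ I := by
      have := I.sub_mem hn hrest
      simpa using this
    rw [homogeneousComponent_zero] at h0
    have hc : coeff 0 s ≠ 0 := by rwa [constantCoeff_eq] at hs
    have : homogeneousComponent n f =
        homogeneousComponent n f * C (coeff 0 s) * C (coeff 0 s)⁻¹ := by
      rw [mul_assoc, ← C_mul, mul_inv_cancel₀ hc, C_1, mul_one]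
    rw [this]
    exact I.mul_mem_right _ h0

omit [Fintype ι] in
/-- Elements of `𝔪ᵀ`, `𝔪 = ker constantCoeff`, have no components of degree `< T`. -/
theorem homogeneousComponent_eq_zero_of_mem_pow :
    ∀ (T : ℕ) {p : MvPolynomial σ K},
      p ∈ (RingHom.ker (constantCoeff : MvPolynomial σ K →+* K)) ^ T →
      ∀ t, t < T → homogeneousComponent t p = 0
  | 0, _, _, t, ht => absurd ht (Nat.not_lt_zero t)
  | T + 1, p, hp, t, ht => by
    classical
    rw [pow_succ'] at hp
    revert t
    refine Submodule.mul_induction_on hp (fun m hm q hq => ?_) (fun x y hx hy t ht => ?_)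
    · intro t ht
      have hm0 : homogeneousComponent 0 m = 0 := by
        rw [homogeneousComponent_zero, ← constantCoeff_eq, (RingHom.mem_ker).1 hm, C_0]
      rw [homogeneousComponent_mul_expand]
      refine Finset.sum_eq_zero fun a _ => ?_
      split_ifs with hle
      · rcases Nat.eq_zero_or_pos a with rfl | ha
        · rw [hm0, mul_zero]
        · rw [homogeneousComponent_eq_zero_of_mem_pow T hq (t - a) (by omega), zero_mul]
      · rfl
    · rw [map_add, hx t ht, hy t ht, add_zero]

/-- If every variable has a power in the homogeneous ideal `I`, then `𝔪ᴺ ⊆ I` for some `N`. -/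
theorem ker_pow_le_of_X_pow_mem {m : ℕ} {I : Ideal (MvPolynomial (Fin m) K)}
    (hI : I.IsHomogeneous (homogeneousSubmodule (Fin m) K))
    (hX : ∀ i, ∃ n : ℕ, (X i : MvPolynomial (Fin m) K) ^ n ∈ I) :
    ∃ N : ℕ, (RingHom.ker (constantCoeff : MvPolynomial (Fin m) K →+* K)) ^ N ≤ I := by
  obtain ⟨t₀, ht₀⟩ := idealDegree_eq_of_X_pow_mem hX
  refine ⟨t₀ + 1, fun p hp => ?_⟩
  rw [MvPolynomial.mem_iff_homogeneousComponent_mem hI]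
  intro t
  by_cases ht : t < t₀ + 1
  · rw [homogeneousComponent_eq_zero_of_mem_pow (t₀ + 1) hp t ht]; exact I.zero_mem
  · have hmem : homogeneousComponent t p ∈ idealDegree I t := by
      rw [ht₀ t (by omega) (by omega)]; exact homogeneousComponent_mem t p
    exact ((mem_idealDegree).1 hmem).1

omit [Fintype ι] in
/-- Prefix non-zero-divisor property in membership form gives Mathlib's `IsWeaklyRegular` for
`List.ofFn H`. -/
theorem isWeaklyRegular_of_prefix {k : ℕ} (H : Fin k → MvPolynomial σ K)
    (hnzd : ∀ j : Fin k, ∀ f, H j * f ∈ prefixIdeal H j → f ∈ prefixIdeal H j) :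
    IsWeaklyRegular (MvPolynomial σ K) (List.ofFn H) := by
  refine (isWeaklyRegular_iff_Fin _ _).2 fun i => ?_
  have hi : (i : ℕ) < k := by simpa using i.2
  have hid : (Ideal.ofList ((List.ofFn H).take i) • ⊤ :
      Submodule (MvPolynomial σ K) (MvPolynomial σ K)) =
        (prefixIdeal H i : Ideal (MvPolynomial σ K)) := by
    rw [Ideal.smul_eq_mul, Ideal.mul_top, Ideal.ofList, prefixIdeal]
    congr 1
    ext r
    simp only [Set.mem_setOf_eq, List.mem_take_iff_getElem, List.getElem_ofFn, List.length_ofFn]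
    constructor
    · rintro ⟨j, hj, rfl⟩
      exact ⟨⟨j, by omega⟩, (lt_min_iff.1 hj).1, rfl⟩
    · rintro ⟨i', hi', rfl⟩
      exact ⟨i', lt_min_iff.2 ⟨hi', i'.2⟩, rfl⟩
  refine (isSMulRegular_quotient_iff_mem_of_smul_mem _ _).2 fun f hf => ?_
  rw [hid] at hf ⊢
  simp only [Fin.getElem_fin, List.getElem_ofFn, smul_eq_mul] at hf
  exact hnzd ⟨i, hi⟩ f hf

/-- **`MReg` holds.** -/
theorem mreg_holds : MReg := by
  intro k e hk he H hH hV
  classical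
  -- notation
  set J : Ideal (MvPolynomial (Fin k) ℂ) := Ideal.span (Set.range H) with hJ_def
  set 𝔪 : Ideal (MvPolynomial (Fin k) ℂ) :=
    RingHom.ker (constantCoeff : MvPolynomial (Fin k) ℂ →+* ℂ) with h𝔪_def
  haveI hmax : 𝔪.IsMaximal :=
    RingHom.ker_isMaximal_of_surjective _ fun c => ⟨C c, constantCoeff_C _ c⟩
  have hHm : ∀ i, H i ∈ 𝔪 := by
    intro i
    rw [h𝔪_def, RingHom.mem_ker, constantCoeff_eq]
    exact (hH i).coeff_eq_zero (by rw [map_zero]; omega)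
  -- (E) each `H i ≠ 0`
  have hH0 : ∀ i, H i ≠ 0 := by
    intro i hi0
    obtain ⟨x, hx, hzero⟩ :=
      Literature.RingTheory.KrullDimension.exists_ne_zero_common_zero_of_isHomogeneous
        (fun i' : {i' : Fin k // i' ≠ i} => H i') (fun _ => e) (fun i' => hH i')
        (fun _ => he) (by rw [Fintype.card_subtype_compl, Fintype.card_fin]; simp; omega)
    refine hx (hV x fun i' => ?_)
    by_cases h : i' = i
    · rw [h, hi0, map_zero]
    · exact hzero ⟨i', h⟩
  -- (B) `𝔪ᴺ ⊆ J`
  have hJhom : J.IsHomogeneous (homogeneousSubmodule (Fin k) ℂ) :=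
    Ideal.homogeneous_span _ _ (by rintro x ⟨i, rfl⟩; exact ⟨e, hH i⟩)
  obtain ⟨N, hN⟩ := ker_pow_le_of_X_pow_mem hJhom
    (fun i => exists_X_pow_mem_span H hV i)
  -- (C) the local ring
  let R := Localization.AtPrime 𝔪
  let φ : MvPolynomial (Fin k) ℂ →+* R := algebraMap _ R
  have hφm : ∀ i, φ (H i) ∈ maximalIdeal R := by
    intro i
    rw [← Localization.AtPrime.map_eq_maximalIdeal]
    exact Ideal.mem_map_of_mem _ (hHm i)
  have hdim : ringKrullDim R = (k : WithBot ℕ∞) := by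
    rw [IsLocalization.AtPrime.ringKrullDim_eq_height 𝔪 R, h𝔪_def,
      Literature.RingTheory.KrullDimension.height_ker_constantCoeff]
    rfl
  -- (C+D) prefix non-zero-divisors in `S`
  have hnzd : ∀ j : Fin k, ∀ f, H j * f ∈ prefixIdeal H j → f ∈ prefixIdeal H j := by
    intro j f hf
    have hj := j.2
    -- the list `(φ H_0, …, φ H_{j-1}) ++ [φ H_j] ++ (φ H_{j+1}, …)`
    let x : Fin j → R := fun i => φ (H (Fin.castLE hj.le i))
    let rest : Fin (k - (j + 1)) → R := fun i => φ (H ⟨j + 1 + i, by omega⟩)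
    let Q : List R := (List.ofFn x ++ [φ (H j)]) ++ List.ofFn rest
    have hQm : ∀ q ∈ Q, q ∈ maximalIdeal R := by
      intro q hq
      simp only [Q, List.mem_append, List.mem_ofFn, List.mem_singleton] at hq
      rcases hq with (⟨i, rfl⟩ | rfl) | ⟨i, rfl⟩
      · exact hφm _
      · exact hφm _
      · exact hφm _
    have hlen : (Q.length : WithBot ℕ∞) = ringKrullDim R := by
      rw [hdim]
      have : Q.length = k := by
        simp only [Q, List.length_append, List.length_ofFn, List.length_singleton]; omega
      rw [this]
    have hJle : J.map φ ≤ Ideal.ofList Q := by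
      rw [hJ_def, Ideal.map_span]
      refine Ideal.span_le.2 ?_
      rintro _ ⟨_, ⟨i, rfl⟩, rfl⟩
      refine Ideal.subset_span ?_
      show φ (H i) ∈ Q
      simp only [Q, List.mem_append, List.mem_ofFn, List.mem_singleton]
      rcases lt_trichotomy (i : ℕ) j with hlt | heq | hgt
      · exact Or.inl (Or.inl ⟨⟨i, hlt⟩, by simp [x]⟩)
      · exact Or.inl (Or.inr (by rw [Fin.ext heq]))
      · refine Or.inr ⟨⟨i - (j + 1), by omega⟩, ?_⟩
        simp only [rest]
        congr 2
        exact Fin.ext (by simp; omega)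
    have hNloc : maximalIdeal R ^ N ≤ Ideal.ofList Q := by
      rw [← Localization.AtPrime.map_eq_maximalIdeal, ← Ideal.map_pow]
      exact (Ideal.map_mono hN).trans hJle
    have hreg : IsRegular R Q :=
      Literature.RingTheory.RegularLocalRing.isRegular_of_maximalIdeal_pow_le_ofList hQm hlen hNloc
    have hw : IsWeaklyRegular R (List.ofFn x ++ [φ (H j)]) :=
      ((isWeaklyRegular_append_iff R _ _).1 hreg.toIsWeaklyRegular).1
    -- identify `span (range x)` with the extension of the prefix ideal
    have hPx : (prefixIdeal H j).map φ = Ideal.span (Set.range x) := by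
      rw [prefixIdeal, Ideal.map_span]
      congr 1
      ext r
      constructor
      · rintro ⟨_, ⟨i, hi, rfl⟩, rfl⟩
        exact ⟨⟨i, hi⟩, by simp [x]⟩
      · rintro ⟨i, rfl⟩
        exact ⟨H (Fin.castLE hj.le i), ⟨Fin.castLE hj.le i, by simp [i.2], rfl⟩, rfl⟩
    -- push `H j * f ∈ P` to `R`, use regularity there, pull back
    have h1 : φ f ∈ (prefixIdeal H j).map φ := by
      rw [hPx]
      refine Literature.RingTheory.Koszul.mem_span_of_mul_mem_of_isWeaklyRegular_concat hw ?_
      rw [← hPx, ← map_mul]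
      exact Ideal.mem_map_of_mem _ hf
    obtain ⟨⟨⟨a, ha⟩, ⟨s, hs⟩⟩, has⟩ :=
      (IsLocalization.mem_map_algebraMap_iff 𝔪.primeCompl R).1 h1
    simp only at has
    rw [← map_mul] at has
    obtain ⟨⟨c, hc⟩, hcas⟩ := (IsLocalization.eq_iff_exists 𝔪.primeCompl R).1 has
    simp only at hcas
    have hcs : constantCoeff (c * s) ≠ 0 := by
      rw [map_mul]
      exact mul_ne_zero (fun h0 => hc ((RingHom.mem_ker).2 h0)) (fun h0 => hs ((RingHom.mem_ker).2 h0))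
    refine mem_of_mul_mem_of_constantCoeff_ne_zero (prefixIdeal_isHomogeneous H hH j) hcs ?_
    have : c * s * f = c * (f * s) := by ring
    rw [this, hcas]
    exact Ideal.mul_mem_left _ _ ha
  exact ⟨hH0, hnzd, Literature.RingTheory.Koszul.hasKoszulSyzygies_of_isWeaklyRegular H
    (isWeaklyRegular_of_prefix H hnzd)⟩

end MRegProof

end Summit.ValiantsHypothesis.ValiantsHypothesis.Theorems.BarrierLever.HBasis
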